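import Mathlib.Analysis.InnerProductSpace.PiL2
import Literature.Topology.Euclidean.BrouwerAcuteAngle
import HarnessLib

/-!
# The acute-angle form of Brouwer's fixed-point theorem on `Fin m → ℝ` (`stub_acuteAngle`)

Stub `stub_acuteAngle` of the line `defect-compactness-design` for the crux `WindowTraceArch`
(stmt-RiemannHypothesis-11195; skeleton
`Summit.RiemannHypothesis.RiemannHypothesis.Cruxes.WindowTraceArch.DefectCompactnessDesign`).

**Statement.** Let `m : ℕ`, `R > 0`, and let `f : (Fin m → ℝ) → (Fin m → ℝ)` be continuous with
`0 ≤ ∑ i, c i * f c i` whenever `∑ i, c i ^ 2 = R ^ 2`. Then there is `c` with `∑ i, c i ^ 2 ≤ R ^ 2`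
and `f c = 0`. (The function space `Fin m → ℝ` carries the sup norm, which is why the sphere and the
ball are written with explicit sums of squares.) This is the form consumed verbatim by `stub_design`
(Bondarenko–Radchenko–Viazovska, *Optimal asymptotic bounds for spherical designs*, Ann. of Math.
178 (2013), Lemma 1; Temam, *Navier–Stokes Equations* (1979), Ch. II, Lemma 1.4).

**Proof.** Pure transport of the tree's
`Literature.Topology.Euclidean.Brouwer.exists_zero_of_inner_nonneg_on_sphere` (file
`Literature/Topology/Euclidean/BrouwerAcuteAngle.lean`, proved there from Brouwer's fixed-point
theorem) along the identification `EuclideanSpace ℝ (Fin m) = WithLp 2 (Fin m → ℝ)`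
(`WithLp.toLp` / `WithLp.ofLp`, both continuous): the field `P ξ := toLp 2 (f (ofLp ξ))` is
continuous, `⟪P ξ, ξ⟫ = ∑ i, ξ i * f ξ i` (`EuclideanSpace.inner_eq_star_dotProduct`), and the
Euclidean sphere / closed ball of radius `R` about `0` are `{∑ i, ξ i ^ 2 = R ^ 2}` /
`{∑ i, ξ i ^ 2 ≤ R ^ 2}` (`EuclideanSpace.sphere_zero_eq`, `EuclideanSpace.closedBall_zero_eq`).
The case `m = 0` needs no special treatment.

**Sources.** R. Temam, *Navier–Stokes Equations. Theory and Numerical Analysis* (1979), Ch. II,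
Lemma 1.4; A. Bondarenko, D. Radchenko, M. Viazovska, Ann. of Math. 178 (2013), Lemma 1;
L. C. Evans, *Partial Differential Equations* (2010), §9.1. All ingredients are proved tree /
Mathlib facts. [folklore]
-/

set_option linter.dupNamespace false

noncomputable section

open Metric WithLp

namespace Summit.RiemannHypothesis.RiemannHypothesis.Theorems.SpectralTraceWindowTraceArch

/-- **stub_acuteAngle — the acute-angle form of Brouwer's fixed-point theorem on `ℝ^m` with the
sup-norm coordinates `Fin m → ℝ`.** A continuous self-map `f` of `Fin m → ℝ` with
`0 ≤ ∑ i, c i * f c i` on the Euclidean sphere `∑ i, c i ^ 2 = R ^ 2` (`R > 0`) has a zero `c` with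
`∑ i, c i ^ 2 ≤ R ^ 2` (Temam 1979, Ch. II, Lemma 1.4; Bondarenko–Radchenko–Viazovska 2013,
Lemma 1). Proof: transport `Literature.Topology.Euclidean.Brouwer.exists_zero_of_inner_nonneg_on_sphere`
along `EuclideanSpace ℝ (Fin m) ≃ (Fin m → ℝ)` (`WithLp.toLp` / `WithLp.ofLp`). [folklore] -/
theorem stub_acuteAngle :
    ∀ (m : ℕ) (R : ℝ), 0 < R → ∀ f : (Fin m → ℝ) → (Fin m → ℝ), Continuous f →
      (∀ c : Fin m → ℝ, ∑ i, c i ^ 2 = R ^ 2 → 0 ≤ ∑ i, c i * f c i) →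
      ∃ c : Fin m → ℝ, ∑ i, c i ^ 2 ≤ R ^ 2 ∧ f c = 0 := by
  intro m R hR f hf hpos
  -- the field transported to the Euclidean space `ℝ^m = WithLp 2 (Fin m → ℝ)`
  set P : EuclideanSpace ℝ (Fin m) → EuclideanSpace ℝ (Fin m) :=
    fun ξ => toLp 2 (f (ofLp ξ)) with hP
  have hPc : Continuous P :=
    (PiLp.continuous_toLp 2 _).comp (hf.comp (PiLp.continuous_ofLp 2 _))
  -- the sign condition on the Euclidean sphere of radius `R`
  have hsphere : ∀ ξ : EuclideanSpace ℝ (Fin m), ‖ξ‖ = R → 0 ≤ inner ℝ (P ξ) ξ := by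
    intro ξ hξ
    have hmem : ξ ∈ sphere (0 : EuclideanSpace ℝ (Fin m)) R := mem_sphere_zero_iff_norm.2 hξ
    rw [EuclideanSpace.sphere_zero_eq R hR.le] at hmem
    have h := hpos (ofLp ξ) hmem
    rw [EuclideanSpace.inner_eq_star_dotProduct, star_trivial]
    simpa [hP, dotProduct] using h
  obtain ⟨ξ, hξ, hPξ⟩ :=
    Literature.Topology.Euclidean.Brouwer.exists_zero_of_inner_nonneg_on_sphere hR
      hPc.continuousOn hsphere
  refine ⟨ofLp ξ, ?_, ?_⟩
  · rw [EuclideanSpace.closedBall_zero_eq R hR.le] at hξ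
    exact hξ
  · have h := congrArg ofLp hPξ
    simpa [hP] using h

end Summit.RiemannHypothesis.RiemannHypothesis.Theorems.SpectralTraceWindowTraceArch

end
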